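import Summits.QuantumFields.YangMills.Theorems.BalabanUVNodesN15CovariantAveragingPropagatorRows
import HarnessLib

/-!
# N15 = NE2 — PROGRAMME 𝟙P «ONE PROPAGATOR», part (𝟙P-g): THE INCREMENT ROW FOR ANY LIVE SUMMAND — (I-b) ∕ (𝟙P-e) §2 RE-CUT with the propagator's decay, its right-inverse identity and the
# summand's row DISPLAYED (the socket for dag-n15-c's (P-R) propagator with Bałaban's fully covariant summand `a·Q*(U)Q(U) − D_UR(U)D*_U`)
# (dag-n15-a g32, FILE (𝟙P-g); node N15 = NE2; `--kind proof --supports stmt-QuantumFields-27366 --as helper`, count-neutral; two theorems, 0 def; imports (𝟙P-e))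

WHY ∕ HOW.  (I-b) (FILE 133's propagator, summand flat), (𝟙P-e) §2 (dag-n15-c's `X_q`, covariant averaging summand `N_V^Q` live) and the coming (P-R) row (their `X_r`, fully covariant
summand `N_V^Q + N_V^R` live — 201∕204∕206∕207) share ONE mechanism: the exact increment identity (𝟙P-e) `sub_tensorId_gOp_eq_of_comp_eq_id_nv` — `X∘(Δ_{e^{ηĀ′}} + (N_L − NV)) = 1` ⟹
`X − G⊗1 = X∘(V_R + NV)∘(G⊗1)` — the species chain for `X∘V_R∘(G⊗1)` (n15-w2 `twoSidedLetters_curvCoef_one_of_meanGauge` in the C² window of `A′`, M1 `hasMaj_unstackM`, FILE 21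
`uniform_layer_fullGM₂`, FILE 28 `unstackM_comp_stack_eq_speciesOpM_comp`, [B11] `hasMaj_comp_exp`) and ONE sandwich `X∘NV∘(G⊗1)` ((Q-1) `hasMaj_sandwich_exp_ofBlocks`).  This file states it with
the three inputs DISPLAYED — the propagator's block majorant `B·e^{−δ₁d}`, its right-inverse identity against `covLapM τ η (gaugePair τ (Ad e^{ηĀ′})) + (cvNL − NV)`, and the summand's row
`ρ_V·e^{−δ₁d}` — so that every glued family of dag-n15-c in the skew parametrisation of FILE 133 (transporters `Ad e^{ηĀ′}` coarse, `Ad e^{η′A′}` fine) gets its increment row by `exact`: the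
constants `(δ, K)` depend on `(d, L, a, ι, δ₁, B)` only.

WHAT.  ★★ `hasMaj_sub_tensorId_gOp_of_liveSummand` (coarse spacing): `∃ δ ≤ δ₁, K > 0, ∀ k ≥ 1 … (C² window of A′) … ∀ NV ρ_V X, [rows] → |X − G⊗1| ≤ K(κ_e r_A + ρ_V)e^{−δd}`;
★★ `hasMaj_sub_tensorId_gOp_of_liveSummand_fine` (fine spacing, fine blocks).  Operator-norm scope as (𝟙P-e) ∕ 191.

HONEST FRAMING ∕ LIMITS.  Block-majorant bookkeeping; NO propagator constructed, no pair spec proved here (they are dag-n15-c's FILE 120∕133∕191∕204); MODEL carriers (two-spacing glued doubled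
torus, global small-field gauge `u ≡ 1`, King-block-mean pairing, `L ≥ 7`); NOT [B9] Thm 3.1 AS PRINTED; no layer of NE2; N15 stays DISCHARGED OF RECORD 8∕28 AS CONSUMED (U-blind v7 pin, p687738)
— nothing re-claimed, no count moved; K3⁸ OPEN; finite 𝕋⁴ per index — NOT ℝ⁴ ∕ OS ∕ mass gap ∕ Clay.  `set_option maxHeartbeats 800000 in` ×2 ((I-b)'s budget).  No `sorry`, `def`, `instance`,
`notation`; standard axioms.
[cite: Balaban1985BackgroundPropagators, (3.26) p.395, (3.50)–(3.53) p.400, (3.62)–(3.65) pp.402–403, Thm 3.1 (3.42) p.397 (shapes); Balaban1984PropagatorsI, (1.69) p.29, (1.71) p.30, Prop. 1.2 (1.110)–(1.111) p.35;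
Balaban1984PropagatorsII, (2.52)–(2.56) pp.232–233, Lemma 2.1 (2.61) p.234; King1986, p.664 (the pairing)]
-/

noncomputable section

open scoped BigOperators Matrix

namespace Summit.QuantumFields.YangMills.BalabanUVNodes.N15.GluedZeroField

open Literature.MathematicalPhysics.QuantumFieldTheory.Balaban1983to89
open Literature.MathematicalPhysics.QuantumFieldTheory.Balaban1983to89.B5Prop11Plancherel (Tor fine)
open Literature.MathematicalPhysics.QuantumFieldTheory.Balaban1983to89.B11SectG (BlockNorm HasMaj RowSum hasMaj_comp_exp)
open Literature.MathematicalPhysics.QuantumFieldTheory.Balaban1983to89.B6UnitTorusCarrier (unitTorusGeo unitTorusGeo_dist unitTorusGeo_dist_nonneg triangle254_unitTorusGeo rowSum_unitTorusGeo)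
open Literature.MathematicalPhysics.QuantumFieldTheory.Balaban1983to89.T4EtaRateCoeffDefect (diagK pull)
open Literature.MathematicalPhysics.QuantumFieldTheory.King1986.Torus (blockOf tdistT)
open Literature.Barriers.QuantumFields (traceForm)
open Summit.QuantumFields.YangMills.BalabanUVNodes.N15.BackgroundLayer (covLapM tCoefA tCoefC gavgM speciesOpM stack unstackM blkPair hasMaj_stack hasMaj_unstackM dPiecesM₂
  dPiecesM₂_inl dPiecesM₂_inr uniform_layer_fullGM₂ unstackM_comp_stack_eq_speciesOpM_comp)
open Summit.QuantumFields.YangMills.BalabanUVNodes.N15.BackgroundModel (kappa_ofBlocks)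
open Summit.QuantumFields.YangMills.BalabanUVNodes.N15.SiteLayer (hasMaj_diagK_comp_exp hasMaj_exp_mono)
open Summit.QuantumFields.YangMills.BalabanUVNodes.N15.VectorPiece (bshiftEquiv kingPrV tensorId kingPrV_bshiftEquiv_pow fibre_conn_kingPrV bshiftEquiv_comm blkFine_comp_kingPrV)
open Summit.QuantumFields.YangMills.BalabanUVNodes.N15.MatrixSpecies (coordMat basisConst basisConst_nonneg liftBlk liftMap)
open Summit.QuantumFields.YangMills.BalabanUVNodes.N15.TwoGrid (gOp)
open Summit.QuantumFields.YangMills.BalabanUVNodes.N15.CurvedSpecies (gaugePair expTrField curvCoefC_one curvCoefA_one twoSidedLetters_curvCoef_one_of_meanGauge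
  coordMat_adCLM_transpose_eq_neg_of_conjTranspose)
open Summit.QuantumFields.YangMills.BalabanUVNodes.N15.Gluing (cvM CvX CvX' cvBlk CvNorm cvNL cvNL' gavgM_conjTranspose_of_skew conj_one_exp_eq_expTrField)
open Literature.MathematicalPhysics.QuantumFieldTheory.Balaban1983to89.Beta.AveragingCorrectionJets (adCLM)

variable {d : ℕ} {L : ℕ} [NeZero L]

open scoped Matrix.Norms.L2Operator

/-! ## §1 Coarse spacing -/

set_option maxHeartbeats 800000 in
/-- ★★ **THE INCREMENT ROW FOR ANY LIVE SUMMAND, COARSE SPACING.**  `L ≥ 7` odd, `a > 0`, `ι` nonempty, and a decay pair `(δ₁, B)` with `δ₁, B > 0`.  There are `δ ∈ (0, δ₁]` and `K > 0`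
(from `d, L, a, ι, δ₁, B`) such that for every `k ≥ 1`, trace-form coordinates `e`, skew-Hermitian fine potential `A′` in the C² window at scale `r_A` with the species window
`2(1+|F|)(3+2(d+1))r_A ≤ 1`, every summand `NV` with `|NV| ≤ ρ_V·e^{−δ₁d}` (`ρ_V ≥ 0`) and every `X` with `|X| ≤ B·e^{−δ₁d}` and `X∘(Δ_{Ad e^{ηĀ′}} + (N_L − NV)) = 1`:
`|X − G⊗1| ≤ K·(κ_e r_A + ρ_V)·e^{−δd}` blockwise on the cover's coarse blocks. [cite: Balaban1985BackgroundPropagators, (3.62)–(3.65) pp.402–403, (3.26) p.395, (3.50)–(3.53) p.400; Balaban1984PropagatorsII, (2.52)–(2.56) pp.232–233] -/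
theorem hasMaj_sub_tensorId_gOp_of_liveSummand (hL : Odd L ∧ 1 < L) (hL7 : 7 ≤ L) {a : ℝ} (ha : 0 < a) (ι : Type) [Fintype ι] [DecidableEq ι] [Nonempty ι]
    {δ₁ B : ℝ} (hδ₁ : 0 < δ₁) (hB : 0 < B) :
    ∃ δ K : ℝ, 0 < δ ∧ δ ≤ δ₁ ∧ 0 < K ∧
      ∀ (mv kk r : ℕ), 1 ≤ kk →
      ∀ {mm : Type} [Fintype mm] [DecidableEq mm] (e : Matrix mm mm ℂ ≃L[ℝ] (ι → ℝ)), (∀ A B : Matrix mm mm ℂ, traceForm A B = e A ⬝ᵥ e B) →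
      ∀ (A' : Fin (d + 1) → CvX' d L mv kk r hL → Matrix mm mm ℂ), (∀ μ x', (A' μ x')ᴴ = -A' μ x') →
      ∀ (rA : ℝ), 0 ≤ rA → (∀ μ x', ‖A' μ x'‖ ≤ rA) →
        (∀ μ κ x', ‖A' μ (bshiftEquiv (cvM d L mv kk hL) (L ^ r * L ^ kk) κ x') - A' μ x'‖ ≤ rA * ((((L ^ r * L ^ kk : ℕ) : ℝ))⁻¹)) →
        (∀ μ κ x', ‖(A' μ (bshiftEquiv (cvM d L mv kk hL) (L ^ r * L ^ kk) κ x') - A' μ x') -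
            (A' μ (bshiftEquiv (cvM d L mv kk hL) (L ^ r * L ^ kk) κ ((bshiftEquiv (cvM d L mv kk hL) (L ^ r * L ^ kk) μ).symm x')) -
              A' μ ((bshiftEquiv (cvM d L mv kk hL) (L ^ r * L ^ kk) μ).symm x'))‖ ≤ rA * ((((L ^ r * L ^ kk : ℕ) : ℝ))⁻¹) * ((((L ^ r * L ^ kk : ℕ) : ℝ))⁻¹)) →
        2 * ((1 + Fintype.card (Fin (d + 1))) * ((3 + 2 * ((d : ℝ) + 1)) * rA)) ≤ 1 →
      ∀ (NV : (CvX d L mv kk hL × ι → ℝ) →ₗ[ℝ] (CvX d L mv kk hL × ι → ℝ)) (ρV : ℝ), 0 ≤ ρV →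
        HasMaj (CvNorm d L mv kk hL ι) (CvNorm d L mv kk hL ι) NV (fun y y' => ρV * Real.exp (-(δ₁ * (unitTorusGeo L kk (cvM d L mv kk hL)).dist y y'))) →
      ∀ (X : (CvX d L mv kk hL × ι → ℝ) →ₗ[ℝ] (CvX d L mv kk hL × ι → ℝ)),
        HasMaj (CvNorm d L mv kk hL ι) (CvNorm d L mv kk hL ι) X (fun y y' => B * Real.exp (-(δ₁ * (unitTorusGeo L kk (cvM d L mv kk hL)).dist y y'))) →
        X ∘ₗ (covLapM (bshiftEquiv (cvM d L mv kk hL) (L ^ kk)) ((((L ^ kk : ℕ) : ℝ))⁻¹) (gaugePair (bshiftEquiv (cvM d L mv kk hL) (L ^ kk)) (fun μ x => coordMat e (ContinuousLinearMap.mulLeftRight ℝ (Matrix mm mm ℂ) (NormedSpace.exp (((((L ^ kk : ℕ) : ℝ))⁻¹) • gavgM (Matrix mm mm ℂ) (Fin (d + 1)) (kingPrV L kk r (cvM d L mv kk hL)) A' μ x)) (NormedSpace.exp (((((L ^ kk : ℕ) : ℝ))⁻¹) • gavgM (Matrix mm mm ℂ) (Fin (d + 1)) (kingPrV L kk r (cvM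 d L mv kk hL)) A' μ x))ᴴ))) + (cvNL d L mv kk hL a ι - NV)) = LinearMap.id →
        HasMaj (CvNorm d L mv kk hL ι) (CvNorm d L mv kk hL ι) (X - tensorId ι (gOp (cvM d L mv kk hL) (L ^ kk) a))
          (fun y y' => K * (basisConst e * rA + ρV) * Real.exp (-(δ * (unitTorusGeo L kk (cvM d L mv kk hL)).dist y y'))) := by
  have hLpos : 0 < L := Nat.pos_of_ne_zero (NeZero.ne L)
  have hL2 : 2 ≤ L := le_trans (by norm_num) hL7
  -- FILE 21 (the flat family's uniform letters, rate `δ_G ≤ δ₁`)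
  obtain ⟨δG, βG, m₀, cT, mT, hδG, hδG₁, hβG, -, -, -, -, HG⟩ := uniform_layer_fullGM₂ d ι hL.1 hL2 hL ha (γ := 1 / 16) (by norm_num) le_rfl 0 hδ₁ le_rfl
  have hσ : 0 < δG / 2 := by positivity
  have hσ₄ : 0 < δG / 4 := by positivity
  set cr : ℝ := B4Sect5Proof.latticeConst (d + 1) (δG / 2) + 1 with hcr
  set c₄ : ℝ := B4Sect5Proof.latticeConst (d + 1) (δG / 4) + 1 with hc₄
  have hcr0 : 0 < cr := by have := B4Sect5Proof.latticeConst_nonneg (d + 1) hσ.le; rw [hcr]; linarith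
  have hc₄0 : 0 < c₄ := by have := B4Sect5Proof.latticeConst_nonneg (d + 1) hσ₄.le; rw [hc₄]; linarith
  set Rs : ℝ := 14 * Real.exp 1 * (1 + Fintype.card (Fin (d + 1))) * ((1 + Fintype.card (Fin (d + 1))) * (3 + 2 * ((d : ℝ) + 1))) * (1 + Fintype.card (Fin (d + 1) ⊕ Fin (d + 1)))
    with hRs
  have hRs0 : 0 < Rs := by positivity
  set K : ℝ := B * Rs * βG * cr + B * 1 * βG * cr * c₄ + 1 with hK
  have hK1' : 0 ≤ B * Rs * βG * cr := by positivity
  have hK2' : 0 ≤ B * 1 * βG * cr * c₄ := by positivity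
  have hKpos : 0 < K := by rw [hK]; linarith
  have hK1 : B * Rs * βG * cr ≤ K := by rw [hK]; linarith
  have hK2 : B * 1 * βG * cr * c₄ ≤ K := by rw [hK]; linarith
  refine ⟨δG / 4, K, hσ₄, by linarith, hKpos, fun mv kk r hk => ?_⟩
  intro mm _ _ e he A' hA' rA hrA h1 h2 h3 hr2 NV ρV hρV hNV₁ X hX hXT
  have hkpos : (0 : ℝ) < ((L ^ kk : ℕ) : ℝ) := Nat.cast_pos.mpr (pow_pos hLpos kk)
  have hrkpos : (0 : ℝ) < ((L ^ r * L ^ kk : ℕ) : ℝ) := Nat.cast_pos.mpr (Nat.mul_pos (pow_pos hLpos r) (pow_pos hLpos kk))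
  have hη : (0 : ℝ) < ((((L ^ kk : ℕ) : ℝ))⁻¹) := inv_pos.mpr hkpos
  have hη' : (0 : ℝ) < ((((L ^ r * L ^ kk : ℕ) : ℝ))⁻¹) := inv_pos.mpr hrkpos
  have hN : ((((L ^ kk : ℕ) : ℝ))⁻¹) = ((L ^ r : ℕ) : ℝ) * ((((L ^ r * L ^ kk : ℕ) : ℝ))⁻¹) := by
    have hr0 : ((L ^ r : ℕ) : ℝ) ≠ 0 := Nat.cast_ne_zero.mpr (pow_ne_zero _ (NeZero.ne L))
    rw [Nat.cast_mul]; field_simp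
  have hη1 : ((((L ^ kk : ℕ) : ℝ))⁻¹) ≤ 1 := inv_le_one_of_one_le₀ (by exact_mod_cast Nat.one_le_pow kk L hLpos)
  have hη'1 : ((((L ^ r * L ^ kk : ℕ) : ℝ))⁻¹) ≤ 1 := inv_le_one_of_one_le₀ (by exact_mod_cast Nat.mul_pos (Nat.one_le_pow r L hLpos) (Nat.one_le_pow kk L hLpos))
  have hC₀ : (0 : ℝ) ≤ 2 * ((d : ℝ) + 1) := by positivity
  have hCθ : ((2 * ((d + 1) * (L ^ r - 1)) : ℕ) : ℝ) * ((((L ^ r * L ^ kk : ℕ) : ℝ))⁻¹) ≤ 2 * ((d : ℝ) + 1) * ((((L ^ kk : ℕ) : ℝ))⁻¹) := by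
    have hsub : (((L ^ r - 1 : ℕ)) : ℝ) ≤ ((L ^ r : ℕ) : ℝ) := by exact_mod_cast Nat.sub_le _ _
    have hcast : ((2 * ((d + 1) * (L ^ r - 1)) : ℕ) : ℝ) = 2 * ((d : ℝ) + 1) * (((L ^ r - 1 : ℕ)) : ℝ) := by push_cast; ring
    rw [hcast, hN]
    calc 2 * ((d : ℝ) + 1) * (((L ^ r - 1 : ℕ)) : ℝ) * ((((L ^ r * L ^ kk : ℕ) : ℝ))⁻¹) ≤ 2 * ((d : ℝ) + 1) * ((L ^ r : ℕ) : ℝ) * ((((L ^ r * L ^ kk : ℕ) : ℝ))⁻¹) :=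
          mul_le_mul_of_nonneg_right (mul_le_mul_of_nonneg_left hsub hC₀) hη'.le
      _ = 2 * ((d : ℝ) + 1) * (((L ^ r : ℕ) : ℝ) * ((((L ^ r * L ^ kk : ℕ) : ℝ))⁻¹)) := by ring
  -- King's pairing geometry and skewness in coordinates
  have hcomm := fun μ κ (x : CvX' d L mv kk r hL) => bshiftEquiv_comm (cvM d L mv kk hL) (L ^ r * L ^ kk) μ κ x
  have hconn := fun (f : CvX' d L mv kk r hL → Matrix mm mm ℂ) (β : ℝ)
      (hf : ∀ κ x, ‖f (bshiftEquiv (cvM d L mv kk hL) (L ^ r * L ^ kk) κ x) - f x‖ ≤ β) => fibre_conn_kingPrV L kk r (cvM d L mv kk hL) f β hf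
  have hblk := fun μ (x' : CvX' d L mv kk r hL) => kingPrV_bshiftEquiv_pow L kk r (cvM d L mv kk hL) μ x'
  have hAm : ∀ μ x, (gavgM (Matrix mm mm ℂ) (Fin (d + 1)) (kingPrV L kk r (cvM d L mv kk hL)) A' μ x)ᴴ = -gavgM (Matrix mm mm ℂ) (Fin (d + 1)) (kingPrV L kk r (cvM d L mv kk hL)) A' μ x := gavgM_conjTranspose_of_skew (kingPrV L kk r (cvM d L mv kk hL)) hA'
  have hA'c := fun μ x' => coordMat_adCLM_transpose_eq_neg_of_conjTranspose e he (hA' μ x')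
  have hAmc := fun μ x => coordMat_adCLM_transpose_eq_neg_of_conjTranspose e he (hAm μ x)
  obtain ⟨hc, hcA, hc', hcA', -, -, -, -, -, -, -, -, -, -, -⟩ :=
    twoSidedLetters_curvCoef_one_of_meanGauge e (π := (kingPrV L kk r (cvM d L mv kk hL))) (s := bshiftEquiv (cvM d L mv kk hL) (L ^ kk))
      (s' := bshiftEquiv (cvM d L mv kk hL) (L ^ r * L ^ kk)) (N := L ^ r) (θ := ((((L ^ kk : ℕ) : ℝ))⁻¹)) (Cπ := ((2 * ((d + 1) * (L ^ r - 1)) : ℕ) : ℝ)) (C₀ := 2 * ((d : ℝ) + 1))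
      hcomm hconn hblk hη' hN hη hη1 le_rfl hC₀ hCθ hrA hr2 hA'c hAmc h1 h2 h3
  have hce : ∀ {X : Type} (η : ℝ) {A : Fin (d + 1) → X → Matrix mm mm ℂ}, (∀ μ x, (A μ x)ᴴ = -A μ x) →
      (fun μ x => coordMat e (ContinuousLinearMap.mulLeftRight ℝ (Matrix mm mm ℂ) ((1 : Matrix mm mm ℂ) * NormedSpace.exp (η • A μ x) * (1 : Matrix mm mm ℂ)ᴴ)
        ((1 : Matrix mm mm ℂ) * NormedSpace.exp (η • A μ x) * (1 : Matrix mm mm ℂ)ᴴ)ᴴ)) = expTrField e η (fun μ x => adCLM ℝ (A μ x)) :=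
    fun η _ hA => conj_one_exp_eq_expTrField e η hA
  rw [curvCoefC_one, curvCoefA_one, ← hce ((((L ^ kk : ℕ) : ℝ))⁻¹) hAm] at hc hcA
  rw [curvCoefC_one, curvCoefA_one, ← hce ((((L ^ r * L ^ kk : ℕ) : ℝ))⁻¹) hA'] at hc' hcA'
  simp only [Matrix.conjTranspose_one, Matrix.mul_one, Matrix.one_mul] at hc hcA hc' hcA'
  -- abbreviations
  set M := cvM d L mv kk hL with hM
  set τ := bshiftEquiv (cvM d L mv kk hL) (L ^ kk) with hτ
  set S : Fin (d + 1) → CvX d L mv kk hL → Matrix ι ι ℝ := fun μ x => coordMat e (ContinuousLinearMap.mulLeftRight ℝ (Matrix mm mm ℂ)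
      (NormedSpace.exp (((((L ^ kk : ℕ) : ℝ))⁻¹) • gavgM (Matrix mm mm ℂ) (Fin (d + 1)) (kingPrV L kk r (cvM d L mv kk hL)) A' μ x))
      (NormedSpace.exp (((((L ^ kk : ℕ) : ℝ))⁻¹) • gavgM (Matrix mm mm ℂ) (Fin (d + 1)) (kingPrV L kk r (cvM d L mv kk hL)) A' μ x))ᴴ) with hS
  have htri := triangle254_unitTorusGeo L kk M
  have hd := fun y y' => unitTorusGeo_dist_nonneg L kk M y y'
  have hrow₂ : RowSum (unitTorusGeo L kk M) (δG / 2) cr := fun y => (rowSum_unitTorusGeo L kk M hσ y).trans (by rw [hcr]; linarith)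
  have hrow₄ : RowSum (unitTorusGeo L kk M) (δG / 4) c₄ := fun y => (rowSum_unitTorusGeo L kk M hσ₄ y).trans (by rw [hc₄]; linarith)
  have hκ0 : 0 ≤ basisConst e := basisConst_nonneg e
  have hRc0 : 0 ≤ 14 * Real.exp 1 * (1 + Fintype.card (Fin (d + 1))) * basisConst e * ((1 + Fintype.card (Fin (d + 1))) * ((3 + 2 * ((d : ℝ) + 1)) * rA)) := by positivity
  have hRc : 14 * Real.exp 1 * (1 + Fintype.card (Fin (d + 1))) * basisConst e * ((1 + Fintype.card (Fin (d + 1))) * ((3 + 2 * ((d : ℝ) + 1)) * rA)) *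
      (1 + Fintype.card (Fin (d + 1) ⊕ Fin (d + 1))) = Rs * basisConst e * rA := by rw [hRs]; ring
  -- the species row `V_R = unstackM (c, a±)` (M1 `hasMaj_unstackM`) composed with FILE 21's stacked `(G ⊗ 1, quotients)` (coarse)
  have hV : HasMaj (BlockNorm.ofBlocks (unitTorusGeo L kk M) (blkPair (liftBlk (cvBlk d L mv kk hL) ι))) (CvNorm d L mv kk hL ι)
      (unstackM (tCoefC ((((L ^ kk : ℕ) : ℝ))⁻¹) (gaugePair τ S)) (tCoefA ((((L ^ kk : ℕ) : ℝ))⁻¹) (gaugePair τ S)))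
      (diagK fun _ => 14 * Real.exp 1 * (1 + Fintype.card (Fin (d + 1))) * basisConst e * ((1 + Fintype.card (Fin (d + 1))) * ((3 + 2 * ((d : ℝ) + 1)) * rA)) *
        (1 + Fintype.card (Fin (d + 1) ⊕ Fin (d + 1)))) :=
    hasMaj_unstackM (g := unitTorusGeo L kk M) (cvBlk d L mv kk hL) hRc0 hc hcA
  obtain ⟨hG0, hD0, hG0', hD0', -⟩ := HG (⟨mv + 1, kk, hk, r⟩, (0 : Fin (d + 1)))
  have hG : HasMaj (CvNorm d L mv kk hL ι) (CvNorm d L mv kk hL ι) (tensorId ι (gOp (M) (L ^ kk) a))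
      (fun y y' => βG * Real.exp (-(δG * (unitTorusGeo L kk M).dist y y'))) := hG0
  have hD : ∀ μ, HasMaj (CvNorm d L mv kk hL ι) (CvNorm d L mv kk hL ι) (dPiecesM₂ d ι M (L ^ kk) a μ)
      (fun y y' => βG * Real.exp (-(δG * (unitTorusGeo L kk M).dist y y'))) := hD0
  have hSt : HasMaj (CvNorm d L mv kk hL ι) (BlockNorm.ofBlocks (unitTorusGeo L kk M) (blkPair (liftBlk (cvBlk d L mv kk hL) ι)))
      (stack (tensorId ι (gOp M (L ^ kk) a)) (dPiecesM₂ d ι M (L ^ kk) a)) (fun y y' => βG * Real.exp (-(δG * (unitTorusGeo L kk M).dist y y'))) :=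
    hasMaj_stack (g := unitTorusGeo L kk M) (liftBlk (cvBlk d L mv kk hL) ι) (fun _ _ => mul_nonneg hβG.le (Real.exp_nonneg _)) hG hD
  have hVG : HasMaj (CvNorm d L mv kk hL ι) (CvNorm d L mv kk hL ι)
      (speciesOpM τ ((L ^ kk : ℕ) : ℝ) (tCoefC ((((L ^ kk : ℕ) : ℝ))⁻¹) (gaugePair τ S)) (tCoefA ((((L ^ kk : ℕ) : ℝ))⁻¹) (gaugePair τ S)) ∘ₗ tensorId ι (gOp M (L ^ kk) a))
      (fun y y' => 14 * Real.exp 1 * (1 + Fintype.card (Fin (d + 1))) * basisConst e * ((1 + Fintype.card (Fin (d + 1))) * ((3 + 2 * ((d : ℝ) + 1)) * rA)) *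
        (1 + Fintype.card (Fin (d + 1) ⊕ Fin (d + 1))) * βG * Real.exp (-(δG * (unitTorusGeo L kk M).dist y y'))) := by
    rw [← unstackM_comp_stack_eq_speciesOpM_comp τ ((L ^ kk : ℕ) : ℝ) (tensorId ι (gOp M (L ^ kk) a)) _ _ (D := dPiecesM₂ d ι M (L ^ kk) a)
      (fun μ => dPiecesM₂_inl (d := d) (ι := ι) M (L ^ kk) a μ) (fun μ => dPiecesM₂_inr (d := d) (ι := ι) M (L ^ kk) a μ)]
    exact hasMaj_diagK_comp_exp (g := unitTorusGeo L kk M) (blkPair (liftBlk (cvBlk d L mv kk hL) ι)) (mul_nonneg hRc0 (by positivity)) hV hSt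
  -- `X_q ∘ V_R ∘ (G ⊗ 1)` ([B11] composition with rates; margin `δ_G∕2`), then slowed to `δ_G∕4`
  have hXVG := hasMaj_comp_exp (b₁ := CvNorm d L mv kk hL ι) (b₂ := CvNorm d L mv kk hL ι) (b₃ := CvNorm d L mv kk hL ι) (ρ := δG / 2) (σ := δG / 2)
    htri hd hrow₂ hB.le (by positivity) hσ.le (by linarith) (by linarith) hX hVG
  have hA : HasMaj (CvNorm d L mv kk hL ι) (CvNorm d L mv kk hL ι)
      (X ∘ₗ
        speciesOpM τ ((L ^ kk : ℕ) : ℝ) (tCoefC ((((L ^ kk : ℕ) : ℝ))⁻¹) (gaugePair τ S)) (tCoefA ((((L ^ kk : ℕ) : ℝ))⁻¹) (gaugePair τ S)) ∘ₗ tensorId ι (gOp M (L ^ kk) a))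
      (fun y y' => B * Rs * basisConst e * rA * βG * cr * Real.exp (-(δG / 4 * (unitTorusGeo L kk M).dist y y'))) := by
    refine (hasMaj_exp_mono hd (by positivity) (by linarith : δG / 4 ≤ δG / 2) (hXVG.mono fun y y' => le_of_eq ?_))
    rw [kappa_ofBlocks, hRs]; ring
  -- the displayed summand: `X ∘ NV ∘ (G ⊗ 1)` ((Q-1) sandwich)
  have hNV : HasMaj (CvNorm d L mv kk hL ι) (CvNorm d L mv kk hL ι) NV (fun y y' => 1 * ρV * Real.exp (-(δG * (unitTorusGeo L kk M).dist y y'))) :=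
    (hasMaj_exp_mono hd hρV hδG₁ hNV₁).mono fun y y' => le_of_eq (by ring)
  have hX₀ := hasMaj_exp_mono hd hB.le hδG₁ hX
  have hBterm := hasMaj_sandwich_exp_ofBlocks htri hd hδG.le hcr0.le hrow₂ hrow₄ hB.le (by positivity : 0 ≤ 1 * ρV) hβG.le hX₀ hNV hG
  -- the increment identity, the sum, the constant
  have hid := sub_tensorId_gOp_eq_of_comp_eq_id_nv mv kk hL ha ι (gaugePair τ S) NV _ hXT
  refine ((hA.add hBterm).congr fun f => by rw [hid, LinearMap.add_comp, LinearMap.comp_add, LinearMap.add_apply]).mono fun y y' => ?_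
  exact amp_incr_le (Kf := 0) hκ0 hrA hρV le_rfl (Real.exp_nonneg _) hKpos.le hK1 hK2 |>.trans (le_of_eq (by ring))

/-! ## §2 Fine spacing -/

set_option maxHeartbeats 800000 in
/-- ★★ **THE INCREMENT ROW FOR ANY LIVE SUMMAND, FINE SPACING** (fine blocks `blockOf (L^rL^k)`, transporters `Ad e^{η′A′}`, summand `NV′`, nonlocal part `cvNL′`): the same letter.
[cite: Balaban1985BackgroundPropagators, (3.62)–(3.65) pp.402–403, (3.26) p.395, (3.50)–(3.53) p.400; Balaban1984PropagatorsII, (2.52)–(2.56) pp.232–233] -/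
theorem hasMaj_sub_tensorId_gOp_of_liveSummand_fine (hL : Odd L ∧ 1 < L) (hL7 : 7 ≤ L) {a : ℝ} (ha : 0 < a) (ι : Type) [Fintype ι] [DecidableEq ι] [Nonempty ι]
    {δ₁ B : ℝ} (hδ₁ : 0 < δ₁) (hB : 0 < B) :
    ∃ δ K : ℝ, 0 < δ ∧ δ ≤ δ₁ ∧ 0 < K ∧
      ∀ (mv kk r : ℕ), 1 ≤ kk →
      ∀ {mm : Type} [Fintype mm] [DecidableEq mm] (e : Matrix mm mm ℂ ≃L[ℝ] (ι → ℝ)), (∀ A B : Matrix mm mm ℂ, traceForm A B = e A ⬝ᵥ e B) →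
      ∀ (A' : Fin (d + 1) → CvX' d L mv kk r hL → Matrix mm mm ℂ), (∀ μ x', (A' μ x')ᴴ = -A' μ x') →
      ∀ (rA : ℝ), 0 ≤ rA → (∀ μ x', ‖A' μ x'‖ ≤ rA) →
        (∀ μ κ x', ‖A' μ (bshiftEquiv (cvM d L mv kk hL) (L ^ r * L ^ kk) κ x') - A' μ x'‖ ≤ rA * ((((L ^ r * L ^ kk : ℕ) : ℝ))⁻¹)) →
        (∀ μ κ x', ‖(A' μ (bshiftEquiv (cvM d L mv kk hL) (L ^ r * L ^ kk) κ x') - A' μ x') -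
            (A' μ (bshiftEquiv (cvM d L mv kk hL) (L ^ r * L ^ kk) κ ((bshiftEquiv (cvM d L mv kk hL) (L ^ r * L ^ kk) μ).symm x')) -
              A' μ ((bshiftEquiv (cvM d L mv kk hL) (L ^ r * L ^ kk) μ).symm x'))‖ ≤ rA * ((((L ^ r * L ^ kk : ℕ) : ℝ))⁻¹) * ((((L ^ r * L ^ kk : ℕ) : ℝ))⁻¹)) →
        2 * ((1 + Fintype.card (Fin (d + 1))) * ((3 + 2 * ((d : ℝ) + 1)) * rA)) ≤ 1 →
      ∀ (NV' : (CvX' d L mv kk r hL × ι → ℝ) →ₗ[ℝ] (CvX' d L mv kk r hL × ι → ℝ)) (ρV : ℝ), 0 ≤ ρV →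
        HasMaj (BlockNorm.ofBlocks (unitTorusGeo L kk (cvM d L mv kk hL)) (liftBlk (fun b : CvX' d L mv kk r hL => blockOf (L ^ r * L ^ kk) (cvM d L mv kk hL) b.1) ι)) (BlockNorm.ofBlocks (unitTorusGeo L kk (cvM d L mv kk hL)) (liftBlk (fun b : CvX' d L mv kk r hL => blockOf (L ^ r * L ^ kk) (cvM d L mv kk hL) b.1) ι)) NV' (fun y y' => ρV * Real.exp (-(δ₁ * (unitTorusGeo L kk (cvM d L mv kk hL)).dist y y'))) →
      ∀ (X' : (CvX' d L mv kk r hL × ι → ℝ) →ₗ[ℝ] (CvX' d L mv kk r hL × ι → ℝ)),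
        HasMaj (BlockNorm.ofBlocks (unitTorusGeo L kk (cvM d L mv kk hL)) (liftBlk (fun b : CvX' d L mv kk r hL => blockOf (L ^ r * L ^ kk) (cvM d L mv kk hL) b.1) ι)) (BlockNorm.ofBlocks (unitTorusGeo L kk (cvM d L mv kk hL)) (liftBlk (fun b : CvX' d L mv kk r hL => blockOf (L ^ r * L ^ kk) (cvM d L mv kk hL) b.1) ι)) X' (fun y y' => B * Real.exp (-(δ₁ * (unitTorusGeo L kk (cvM d L mv kk hL)).dist y y'))) →
        X' ∘ₗ (covLapM (bshiftEquiv (cvM d L mv kk hL) (L ^ r * L ^ kk)) ((((L ^ r * L ^ kk : ℕ) : ℝ))⁻¹) (gaugePair (bshiftEquiv (cvM d L mv kk hL) (L ^ r * L ^ kk)) (fun μ x' => coordMat e (ContinuousLinearMap.mulLeftRight ℝ (Matrix mm mm ℂ) (NormedSpace.exp (((((L ^ r * L ^ kk : ℕ) : ℝ))⁻¹) • A' μ x')) (NormedSpace.exp (((((L ^ r * L ^ kk : ℕ) : ℝ))⁻¹) • A' μ x'))ᴴ))) + (cvNL' d L mv kk r hL a ι - NV')) = LinearMap.id →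
        HasMaj (BlockNorm.ofBlocks (unitTorusGeo L kk (cvM d L mv kk hL)) (liftBlk (fun b : CvX' d L mv kk r hL => blockOf (L ^ r * L ^ kk) (cvM d L mv kk hL) b.1) ι)) (BlockNorm.ofBlocks (unitTorusGeo L kk (cvM d L mv kk hL)) (liftBlk (fun b : CvX' d L mv kk r hL => blockOf (L ^ r * L ^ kk) (cvM d L mv kk hL) b.1) ι)) (X' - tensorId ι (gOp (cvM d L mv kk hL) (L ^ r * L ^ kk) a))
          (fun y y' => K * (basisConst e * rA + ρV) * Real.exp (-(δ * (unitTorusGeo L kk (cvM d L mv kk hL)).dist y y'))) := by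
  have hLpos : 0 < L := Nat.pos_of_ne_zero (NeZero.ne L)
  have hL2 : 2 ≤ L := le_trans (by norm_num) hL7
  obtain ⟨δG, βG, m₀, cT, mT, hδG, hδG₁, hβG, -, -, -, -, HG⟩ := uniform_layer_fullGM₂ d ι hL.1 hL2 hL ha (γ := 1 / 16) (by norm_num) le_rfl 0 hδ₁ le_rfl
  have hσ : 0 < δG / 2 := by positivity
  have hσ₄ : 0 < δG / 4 := by positivity
  set cr : ℝ := B4Sect5Proof.latticeConst (d + 1) (δG / 2) + 1 with hcr
  set c₄ : ℝ := B4Sect5Proof.latticeConst (d + 1) (δG / 4) + 1 with hc₄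
  have hcr0 : 0 < cr := by have := B4Sect5Proof.latticeConst_nonneg (d + 1) hσ.le; rw [hcr]; linarith
  have hc₄0 : 0 < c₄ := by have := B4Sect5Proof.latticeConst_nonneg (d + 1) hσ₄.le; rw [hc₄]; linarith
  set Rs : ℝ := 14 * Real.exp 1 * (1 + Fintype.card (Fin (d + 1))) * ((1 + Fintype.card (Fin (d + 1))) * (3 + 2 * ((d : ℝ) + 1))) * (1 + Fintype.card (Fin (d + 1) ⊕ Fin (d + 1)))
    with hRs
  have hRs0 : 0 < Rs := by positivity
  set K : ℝ := B * Rs * βG * cr + B * 1 * βG * cr * c₄ + 1 with hK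
  have hK1' : 0 ≤ B * Rs * βG * cr := by positivity
  have hK2' : 0 ≤ B * 1 * βG * cr * c₄ := by positivity
  have hKpos : 0 < K := by rw [hK]; linarith
  have hK1 : B * Rs * βG * cr ≤ K := by rw [hK]; linarith
  have hK2 : B * 1 * βG * cr * c₄ ≤ K := by rw [hK]; linarith
  refine ⟨δG / 4, K, hσ₄, by linarith, hKpos, fun mv kk r hk => ?_⟩
  intro mm _ _ e he A' hA' rA hrA h1 h2 h3 hr2 NV' ρV hρV hNV₁ X' hX' hXT'
  have hkpos : (0 : ℝ) < ((L ^ kk : ℕ) : ℝ) := Nat.cast_pos.mpr (pow_pos hLpos kk)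
  have hrkpos : (0 : ℝ) < ((L ^ r * L ^ kk : ℕ) : ℝ) := Nat.cast_pos.mpr (Nat.mul_pos (pow_pos hLpos r) (pow_pos hLpos kk))
  have hη : (0 : ℝ) < ((((L ^ kk : ℕ) : ℝ))⁻¹) := inv_pos.mpr hkpos
  have hη' : (0 : ℝ) < ((((L ^ r * L ^ kk : ℕ) : ℝ))⁻¹) := inv_pos.mpr hrkpos
  have hN : ((((L ^ kk : ℕ) : ℝ))⁻¹) = ((L ^ r : ℕ) : ℝ) * ((((L ^ r * L ^ kk : ℕ) : ℝ))⁻¹) := by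
    have hr0 : ((L ^ r : ℕ) : ℝ) ≠ 0 := Nat.cast_ne_zero.mpr (pow_ne_zero _ (NeZero.ne L))
    rw [Nat.cast_mul]; field_simp
  have hη1 : ((((L ^ kk : ℕ) : ℝ))⁻¹) ≤ 1 := inv_le_one_of_one_le₀ (by exact_mod_cast Nat.one_le_pow kk L hLpos)
  have hη'1 : ((((L ^ r * L ^ kk : ℕ) : ℝ))⁻¹) ≤ 1 := inv_le_one_of_one_le₀ (by exact_mod_cast Nat.mul_pos (Nat.one_le_pow r L hLpos) (Nat.one_le_pow kk L hLpos))
  have hC₀ : (0 : ℝ) ≤ 2 * ((d : ℝ) + 1) := by positivity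
  have hCθ : ((2 * ((d + 1) * (L ^ r - 1)) : ℕ) : ℝ) * ((((L ^ r * L ^ kk : ℕ) : ℝ))⁻¹) ≤ 2 * ((d : ℝ) + 1) * ((((L ^ kk : ℕ) : ℝ))⁻¹) := by
    have hsub : (((L ^ r - 1 : ℕ)) : ℝ) ≤ ((L ^ r : ℕ) : ℝ) := by exact_mod_cast Nat.sub_le _ _
    have hcast : ((2 * ((d + 1) * (L ^ r - 1)) : ℕ) : ℝ) = 2 * ((d : ℝ) + 1) * (((L ^ r - 1 : ℕ)) : ℝ) := by push_cast; ring
    rw [hcast, hN]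
    calc 2 * ((d : ℝ) + 1) * (((L ^ r - 1 : ℕ)) : ℝ) * ((((L ^ r * L ^ kk : ℕ) : ℝ))⁻¹) ≤ 2 * ((d : ℝ) + 1) * ((L ^ r : ℕ) : ℝ) * ((((L ^ r * L ^ kk : ℕ) : ℝ))⁻¹) :=
          mul_le_mul_of_nonneg_right (mul_le_mul_of_nonneg_left hsub hC₀) hη'.le
      _ = 2 * ((d : ℝ) + 1) * (((L ^ r : ℕ) : ℝ) * ((((L ^ r * L ^ kk : ℕ) : ℝ))⁻¹)) := by ring
  -- King's pairing geometry and skewness in coordinates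
  have hcomm := fun μ κ (x : CvX' d L mv kk r hL) => bshiftEquiv_comm (cvM d L mv kk hL) (L ^ r * L ^ kk) μ κ x
  have hconn := fun (f : CvX' d L mv kk r hL → Matrix mm mm ℂ) (β : ℝ)
      (hf : ∀ κ x, ‖f (bshiftEquiv (cvM d L mv kk hL) (L ^ r * L ^ kk) κ x) - f x‖ ≤ β) => fibre_conn_kingPrV L kk r (cvM d L mv kk hL) f β hf
  have hblk := fun μ (x' : CvX' d L mv kk r hL) => kingPrV_bshiftEquiv_pow L kk r (cvM d L mv kk hL) μ x'
  have hAm : ∀ μ x, (gavgM (Matrix mm mm ℂ) (Fin (d + 1)) (kingPrV L kk r (cvM d L mv kk hL)) A' μ x)ᴴ = -gavgM (Matrix mm mm ℂ) (Fin (d + 1)) (kingPrV L kk r (cvM d L mv kk hL)) A' μ x := gavgM_conjTranspose_of_skew (kingPrV L kk r (cvM d L mv kk hL)) hA'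
  have hA'c := fun μ x' => coordMat_adCLM_transpose_eq_neg_of_conjTranspose e he (hA' μ x')
  have hAmc := fun μ x => coordMat_adCLM_transpose_eq_neg_of_conjTranspose e he (hAm μ x)
  obtain ⟨hc, hcA, hc', hcA', -, -, -, -, -, -, -, -, -, -, -⟩ :=
    twoSidedLetters_curvCoef_one_of_meanGauge e (π := (kingPrV L kk r (cvM d L mv kk hL))) (s := bshiftEquiv (cvM d L mv kk hL) (L ^ kk))
      (s' := bshiftEquiv (cvM d L mv kk hL) (L ^ r * L ^ kk)) (N := L ^ r) (θ := ((((L ^ kk : ℕ) : ℝ))⁻¹)) (Cπ := ((2 * ((d + 1) * (L ^ r - 1)) : ℕ) : ℝ)) (C₀ := 2 * ((d : ℝ) + 1))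
      hcomm hconn hblk hη' hN hη hη1 le_rfl hC₀ hCθ hrA hr2 hA'c hAmc h1 h2 h3
  have hce : ∀ {X : Type} (η : ℝ) {A : Fin (d + 1) → X → Matrix mm mm ℂ}, (∀ μ x, (A μ x)ᴴ = -A μ x) →
      (fun μ x => coordMat e (ContinuousLinearMap.mulLeftRight ℝ (Matrix mm mm ℂ) ((1 : Matrix mm mm ℂ) * NormedSpace.exp (η • A μ x) * (1 : Matrix mm mm ℂ)ᴴ)
        ((1 : Matrix mm mm ℂ) * NormedSpace.exp (η • A μ x) * (1 : Matrix mm mm ℂ)ᴴ)ᴴ)) = expTrField e η (fun μ x => adCLM ℝ (A μ x)) :=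
    fun η _ hA => conj_one_exp_eq_expTrField e η hA
  rw [curvCoefC_one, curvCoefA_one, ← hce ((((L ^ kk : ℕ) : ℝ))⁻¹) hAm] at hc hcA
  rw [curvCoefC_one, curvCoefA_one, ← hce ((((L ^ r * L ^ kk : ℕ) : ℝ))⁻¹) hA'] at hc' hcA'
  simp only [Matrix.conjTranspose_one, Matrix.mul_one, Matrix.one_mul] at hc hcA hc' hcA'
  -- abbreviations
  set M := cvM d L mv kk hL with hM
  set τ := bshiftEquiv (cvM d L mv kk hL) (L ^ kk) with hτ
  set S : Fin (d + 1) → CvX d L mv kk hL → Matrix ι ι ℝ := fun μ x => coordMat e (ContinuousLinearMap.mulLeftRight ℝ (Matrix mm mm ℂ)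
      (NormedSpace.exp (((((L ^ kk : ℕ) : ℝ))⁻¹) • gavgM (Matrix mm mm ℂ) (Fin (d + 1)) (kingPrV L kk r (cvM d L mv kk hL)) A' μ x))
      (NormedSpace.exp (((((L ^ kk : ℕ) : ℝ))⁻¹) • gavgM (Matrix mm mm ℂ) (Fin (d + 1)) (kingPrV L kk r (cvM d L mv kk hL)) A' μ x))ᴴ) with hS
  have htri := triangle254_unitTorusGeo L kk M
  have hd := fun y y' => unitTorusGeo_dist_nonneg L kk M y y'
  have hrow₂ : RowSum (unitTorusGeo L kk M) (δG / 2) cr := fun y => (rowSum_unitTorusGeo L kk M hσ y).trans (by rw [hcr]; linarith)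
  have hrow₄ : RowSum (unitTorusGeo L kk M) (δG / 4) c₄ := fun y => (rowSum_unitTorusGeo L kk M hσ₄ y).trans (by rw [hc₄]; linarith)
  have hκ0 : 0 ≤ basisConst e := basisConst_nonneg e
  have hRc0 : 0 ≤ 14 * Real.exp 1 * (1 + Fintype.card (Fin (d + 1))) * basisConst e * ((1 + Fintype.card (Fin (d + 1))) * ((3 + 2 * ((d : ℝ) + 1)) * rA)) := by positivity
  have hRc : 14 * Real.exp 1 * (1 + Fintype.card (Fin (d + 1))) * basisConst e * ((1 + Fintype.card (Fin (d + 1))) * ((3 + 2 * ((d : ℝ) + 1)) * rA)) *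
      (1 + Fintype.card (Fin (d + 1) ⊕ Fin (d + 1))) = Rs * basisConst e * rA := by rw [hRs]; ring
  obtain ⟨hG0, hD0, hG0', hD0', -⟩ := HG (⟨mv + 1, kk, hk, r⟩, (0 : Fin (d + 1)))
  /- the FINE spacing `η′ = L^{−(r+k)}`: the same chain with the fine objects (blocks `blkFine ∘ kingPrV` = the cover's fine blocks, `blkFine_comp_kingPrV`) -/
  set τ' := bshiftEquiv (cvM d L mv kk hL) (L ^ r * L ^ kk) with hτ'
  set S' : Fin (d + 1) → CvX' d L mv kk r hL → Matrix ι ι ℝ := fun μ x' => coordMat e (ContinuousLinearMap.mulLeftRight ℝ (Matrix mm mm ℂ)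
      (NormedSpace.exp (((((L ^ r * L ^ kk : ℕ) : ℝ))⁻¹) • A' μ x')) (NormedSpace.exp (((((L ^ r * L ^ kk : ℕ) : ℝ))⁻¹) • A' μ x'))ᴴ) with hS'
  have hV' : HasMaj (BlockNorm.ofBlocks (unitTorusGeo L kk M) (blkPair (liftBlk (fun b : CvX' d L mv kk r hL => blockOf (L ^ r * L ^ kk) M b.1) ι)))
      (BlockNorm.ofBlocks (unitTorusGeo L kk M) (liftBlk (fun b : CvX' d L mv kk r hL => blockOf (L ^ r * L ^ kk) M b.1) ι))
      (unstackM (tCoefC ((((L ^ r * L ^ kk : ℕ) : ℝ))⁻¹) (gaugePair τ' S')) (tCoefA ((((L ^ r * L ^ kk : ℕ) : ℝ))⁻¹) (gaugePair τ' S')))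
      (diagK fun _ => 14 * Real.exp 1 * (1 + Fintype.card (Fin (d + 1))) * basisConst e * ((1 + Fintype.card (Fin (d + 1))) * ((3 + 2 * ((d : ℝ) + 1)) * rA)) *
        (1 + Fintype.card (Fin (d + 1) ⊕ Fin (d + 1)))) :=
    hasMaj_unstackM (g := unitTorusGeo L kk M) (fun b : CvX' d L mv kk r hL => blockOf (L ^ r * L ^ kk) M b.1) hRc0 hc' hcA'
  rw [blkFine_comp_kingPrV] at hG0' hD0'
  have hG' : HasMaj (BlockNorm.ofBlocks (unitTorusGeo L kk (M)) (liftBlk (fun b : CvX' d L mv kk r hL => blockOf (L ^ r * L ^ kk) (M) b.1) ι))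
      (BlockNorm.ofBlocks (unitTorusGeo L kk (M)) (liftBlk (fun b : CvX' d L mv kk r hL => blockOf (L ^ r * L ^ kk) (M) b.1) ι)) (tensorId ι (gOp M (L ^ r * L ^ kk) a))
      (fun y y' => βG * Real.exp (-(δG * (unitTorusGeo L kk M).dist y y'))) := hG0'
  have hD' : ∀ μ, HasMaj (BlockNorm.ofBlocks (unitTorusGeo L kk (M)) (liftBlk (fun b : CvX' d L mv kk r hL => blockOf (L ^ r * L ^ kk) (M) b.1) ι))
      (BlockNorm.ofBlocks (unitTorusGeo L kk (M)) (liftBlk (fun b : CvX' d L mv kk r hL => blockOf (L ^ r * L ^ kk) (M) b.1) ι)) (dPiecesM₂ d ι M (L ^ r * L ^ kk) a μ)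
      (fun y y' => βG * Real.exp (-(δG * (unitTorusGeo L kk M).dist y y'))) := hD0'
  have hSt' := hasMaj_stack (g := unitTorusGeo L kk M) (liftBlk (fun b : CvX' d L mv kk r hL => blockOf (L ^ r * L ^ kk) M b.1) ι)
    (fun _ _ => mul_nonneg hβG.le (Real.exp_nonneg _)) hG' hD'
  have hVG' : HasMaj (BlockNorm.ofBlocks (unitTorusGeo L kk (M)) (liftBlk (fun b : CvX' d L mv kk r hL => blockOf (L ^ r * L ^ kk) (M) b.1) ι))
      (BlockNorm.ofBlocks (unitTorusGeo L kk (M)) (liftBlk (fun b : CvX' d L mv kk r hL => blockOf (L ^ r * L ^ kk) (M) b.1) ι))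
      (speciesOpM τ' ((L ^ r * L ^ kk : ℕ) : ℝ) (tCoefC ((((L ^ r * L ^ kk : ℕ) : ℝ))⁻¹) (gaugePair τ' S')) (tCoefA ((((L ^ r * L ^ kk : ℕ) : ℝ))⁻¹) (gaugePair τ' S')) ∘ₗ
        tensorId ι (gOp M (L ^ r * L ^ kk) a))
      (fun y y' => 14 * Real.exp 1 * (1 + Fintype.card (Fin (d + 1))) * basisConst e * ((1 + Fintype.card (Fin (d + 1))) * ((3 + 2 * ((d : ℝ) + 1)) * rA)) *
        (1 + Fintype.card (Fin (d + 1) ⊕ Fin (d + 1))) * βG * Real.exp (-(δG * (unitTorusGeo L kk M).dist y y'))) := by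
    rw [← unstackM_comp_stack_eq_speciesOpM_comp τ' ((L ^ r * L ^ kk : ℕ) : ℝ) (tensorId ι (gOp M (L ^ r * L ^ kk) a)) _ _ (D := dPiecesM₂ d ι M (L ^ r * L ^ kk) a)
      (fun μ => dPiecesM₂_inl (d := d) (ι := ι) M (L ^ r * L ^ kk) a μ) (fun μ => dPiecesM₂_inr (d := d) (ι := ι) M (L ^ r * L ^ kk) a μ)]
    exact hasMaj_diagK_comp_exp (g := unitTorusGeo L kk M) (blkPair (liftBlk (fun b : CvX' d L mv kk r hL => blockOf (L ^ r * L ^ kk) M b.1) ι))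
      (mul_nonneg hRc0 (by positivity)) hV' hSt'
  have hXVG' := hasMaj_comp_exp (ρ := δG / 2) (σ := δG / 2) htri hd hrow₂ hB.le (by positivity) hσ.le (by linarith) (by linarith) hX' hVG'
  have hAf : HasMaj (BlockNorm.ofBlocks (unitTorusGeo L kk (M)) (liftBlk (fun b : CvX' d L mv kk r hL => blockOf (L ^ r * L ^ kk) (M) b.1) ι))
      (BlockNorm.ofBlocks (unitTorusGeo L kk (M)) (liftBlk (fun b : CvX' d L mv kk r hL => blockOf (L ^ r * L ^ kk) (M) b.1) ι))
      (X' ∘ₗ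
        speciesOpM τ' ((L ^ r * L ^ kk : ℕ) : ℝ) (tCoefC ((((L ^ r * L ^ kk : ℕ) : ℝ))⁻¹) (gaugePair τ' S')) (tCoefA ((((L ^ r * L ^ kk : ℕ) : ℝ))⁻¹) (gaugePair τ' S')) ∘ₗ
          tensorId ι (gOp M (L ^ r * L ^ kk) a))
      (fun y y' => B * Rs * basisConst e * rA * βG * cr * Real.exp (-(δG / 4 * (unitTorusGeo L kk M).dist y y'))) := by
    refine (hasMaj_exp_mono hd (by positivity) (by linarith : δG / 4 ≤ δG / 2) (hXVG'.mono fun y y' => le_of_eq ?_))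
    rw [kappa_ofBlocks, hRs]; ring
  have hNVf : HasMaj (BlockNorm.ofBlocks (unitTorusGeo L kk (M)) (liftBlk (fun b : CvX' d L mv kk r hL => blockOf (L ^ r * L ^ kk) (M) b.1) ι))
      (BlockNorm.ofBlocks (unitTorusGeo L kk (M)) (liftBlk (fun b : CvX' d L mv kk r hL => blockOf (L ^ r * L ^ kk) (M) b.1) ι)) NV' (fun y y' => 1 * ρV * Real.exp (-(δG * (unitTorusGeo L kk M).dist y y'))) :=
    (hasMaj_exp_mono hd hρV hδG₁ hNV₁).mono fun y y' => le_of_eq (by ring)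
  have hX₀' := hasMaj_exp_mono hd hB.le hδG₁ hX'
  have hBterm' := hasMaj_sandwich_exp_ofBlocks htri hd hδG.le hcr0.le hrow₂ hrow₄ hB.le (by positivity : 0 ≤ 1 * ρV) hβG.le hX₀' hNVf hG'
  have hid' := sub_tensorId_gOp_eq_of_comp_eq_id_nv_fine mv kk r hL ha ι (gaugePair τ' S') NV' _ hXT'
  refine ((hAf.add hBterm').congr fun f => by rw [hid', LinearMap.add_comp, LinearMap.comp_add, LinearMap.add_apply]).mono fun y y' => ?_
  exact amp_incr_le (Kf := 0) hκ0 hrA hρV le_rfl (Real.exp_nonneg _) hKpos.le hK1 hK2 |>.trans (le_of_eq (by ring))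

end Summit.QuantumFields.YangMills.BalabanUVNodes.N15.GluedZeroField

end
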